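import Mathlib.Data.Fintype.Sort
import Literature.Computability.AlgebraicComplexity.ArithCircuitProofs
import Literature.Computability.AlgebraicComplexity.ConstantFreeCircuits
import Literature.Computability.AlgebraicComplexity.ArithCircuitChain
import HarnessLib

/-!
# Weighted sums cost one gate; the chain bound over any finite linear order

Topic `Computability/AlgebraicComplexity`, namespace `Literature.Computability.AlgebraicComplexity`.
Everything PROVED; no named facts, no new definitions.

Two small additions to the cost calculus of the tree's fan-in-two measure `complexity`
(`ArithCircuit.lean`, Bürgisser 2000, Def. 2.1):

* `complexity_wadd_le` : `L(a • f + b • g) ≤ L(f) + L(g) + 1` — a sum gate of Bürgisser's model is a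
  WEIGHTED sum `c • u + d • v`, so the two coefficients are free (the tree's `complexity_add_le` is the
  case `a = b = 1`, and `complexity_smul_le` charges one gate per scalar); `complexity_wsum_le` : a
  weighted sum of `m ≥ 2` terms costs `m - 1` gates beyond its terms. This is what exact gate counts
  at a boundary `n^b` need (e.g. the truncated-product dynamic programme of
  `Summits/…/BarrierLeverSuccinctHittingSetsForVPSeparableCoeffThree*.lean`, where these lemmas were
  first landed; they are re-homed here for general use).
* `complexity_chain_le_linearOrder` : the dynamic-programming bound `complexity_chain_le`
  (`ArithCircuitChain.lean`: a table `f : Fin T → k[X]` with `f t = F t (X, (f s)_{s<t}, 0, …)` has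
  `L(f t) ≤ Σ_s L(F s)`) transported along `monoEquivOfFin` to tables indexed by ANY finite linear
  order `ι` (e.g. lexicographic products `Fin a ×ₗ (Fin b ×ₗ Fin c)`, whose dependency checks are
  `Prod.Lex.lt_iff`).

## References

* [Burgisser2000] P. Bürgisser, *Completeness and Reduction in Algebraic Complexity Theory*,
  Springer 2000, Def. 2.1 (weighted sum gates), proof of Prop. 2.3 / Rem. 2.7 (chains).
-/

noncomputable section

open MvPolynomial

namespace Literature.Computability.AlgebraicComplexity

universe u v

variable {k : Type u} [CommSemiring k] {τ : Type v}

open ArithCircuit in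
/-- **Weighted addition costs one gate**: `L(a • f + b • g) ≤ L(f) + L(g) + 1` — a sum gate of
Bürgisser's model carries its coefficients (the case `a = b = 1` is `complexity_add_le`).
[cite: Burgisser2000, Def. 2.1] -/
theorem complexity_wadd_le (a b : k) (f g : MvPolynomial τ k) :
    complexity (a • f + b • g) ≤ complexity f + complexity g + 1 := by
  obtain ⟨P, hP2, hPc, hPs⟩ := exists_computes_size_eq_complexity f
  obtain ⟨Q, hQ2, hQc, hQs⟩ := exists_computes_size_eq_complexity g
  -- the circuit: `P`, then `Q` shifted, then one sum gate `a • out(P) + b • out(Q)`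
  let R : ArithCircuit k τ :=
    { gates := (P.append Q).gates ++
        [Gate.sum [(a, P.output.truncate P.size), (b, Q.output.shift P.size)]]
      output := Operand.gate (P.size + Q.size) }
  have hR2 : R.IsFanInTwo := by
    intro g' hg'
    simp only [R, List.mem_append, List.mem_singleton] at hg'
    rcases hg' with hg' | rfl
    · exact IsFanInTwo.append hP2 hQ2 g' hg'
    · simp [Gate.fanIn, Gate.args]
  have hRsize : R.size = P.size + Q.size + 1 := by
    simp [R, ArithCircuit.append, ArithCircuit.size, Nat.add_assoc]
  have hReval : R.eval = a • P.eval + b • Q.eval := by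
    have hP := gateValues_length (k := k) P.gates
    have hQ := gateValues_length (k := k) Q.gates
    have h1 := Operand.eval_truncate_append (gateValues P.gates) (gateValues Q.gates) P.output
    have h2 := Operand.eval_shift_append (gateValues P.gates) (gateValues Q.gates) Q.output
    rw [hP] at h1 h2
    simp [R, ArithCircuit.eval, gateValues_append_gates, gateValues_append_singleton, Gate.eval,
      ArithCircuit.size, List.getD_eq_getElem?_getD, hP, hQ, h1, h2]
  have hRc : R.Computes (a • f + b • g) := by
    rw [Computes] at hPc hQc ⊢
    rw [hReval, hPc, hQc]
  calc complexity (a • f + b • g) ≤ R.size := complexity_le_size hR2 hRc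
    _ = complexity f + complexity g + 1 := by rw [hRsize, hPs, hQs]

/-- **Weighted sums**: for `m ≥ 2` terms, `L(Σ_{j<m} a_j • T_j) ≤ Σ_{j<m} L(T_j) + (m - 1)`
(one weighted-addition gate per further term). [cite: Burgisser2000, Def. 2.1] -/
theorem complexity_wsum_le (a : ℕ → k) (T : ℕ → MvPolynomial τ k) :
    ∀ m : ℕ, 2 ≤ m →
      complexity (∑ j ∈ Finset.range m, a j • T j) ≤
        ∑ j ∈ Finset.range m, complexity (T j) + (m - 1) := by
  intro m hm
  induction m, hm using Nat.le_induction with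
  | base =>
    rw [Finset.sum_range_succ, Finset.sum_range_one, Finset.sum_range_succ, Finset.sum_range_one]
    exact complexity_wadd_le _ _ _ _
  | succ m hm ih =>
    rw [Finset.sum_range_succ, Finset.sum_range_succ (fun j => complexity (T j))]
    calc complexity (∑ j ∈ Finset.range m, a j • T j + a m • T m)
        = complexity ((1 : k) • (∑ j ∈ Finset.range m, a j • T j) + a m • T m) := by rw [one_smul]
      _ ≤ complexity (∑ j ∈ Finset.range m, a j • T j) + complexity (T m) + 1 :=
          complexity_wadd_le _ _ _ _
      _ ≤ (∑ j ∈ Finset.range m, complexity (T j) + (m - 1)) + complexity (T m) + 1 := by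
          gcongr
      _ = ∑ j ∈ Finset.range m, complexity (T j) + complexity (T m) + (m + 1 - 1) := by omega

/-- **The chain bound over any finite linear order** (transport of `complexity_chain_le` along
`monoEquivOfFin`): if `f t = F t (X, (f s)_{s < t}, 0, …)` for all `t : ι`, then
`L(f t) ≤ Σ_s L(F s)`. [cite: Burgisser2000, Rem. 2.7] -/
theorem complexity_chain_le_linearOrder {ι : Type} [Fintype ι] [LinearOrder ι]
    (f : ι → MvPolynomial τ k) (F : ι → MvPolynomial (τ ⊕ ι) k)
    (hF : ∀ t : ι, f t = aeval (Sum.elim X (fun s : ι => if s < t then f s else 0)) (F t))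
    (t : ι) : complexity (f t) ≤ ∑ s : ι, complexity (F s) := by
  classical
  set e : Fin (Fintype.card ι) ≃o ι := monoEquivOfFin ι rfl with he
  let f' : Fin (Fintype.card ι) → MvPolynomial τ k := fun s => f (e s)
  let F' : Fin (Fintype.card ι) → MvPolynomial (τ ⊕ Fin (Fintype.card ι)) k :=
    fun s => rename (Sum.map id e.symm) (F (e s))
  have hF' : ∀ t', f' t' =
      aeval (Sum.elim X (fun s : Fin (Fintype.card ι) => if s < t' then f' s else 0)) (F' t') := by
    intro t'
    have hfun : ((Sum.elim X fun s : Fin (Fintype.card ι) => if s < t' then f' s else 0) ∘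
        Sum.map id ⇑e.symm : τ ⊕ ι → MvPolynomial τ k) =
        Sum.elim X (fun s : ι => if s < e t' then f s else 0) := by
      funext x
      rcases x with x | s
      · rfl
      · simp only [f', Function.comp_apply, Sum.map_inr, Sum.elim_inr, OrderIso.apply_symm_apply]
        by_cases hs : s < e t'
        · rw [if_pos hs, if_pos (by simpa using (e.symm.lt_iff_lt).2 hs)]
        · rw [if_neg hs, if_neg (fun h => hs (by simpa using (e.lt_iff_lt).2 h))]
    simp only [F', aeval_rename, hfun]
    exact hF (e t')
  have hmain := complexity_chain_le f' F' hF' (e.symm t)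
  simp only [f', OrderIso.apply_symm_apply] at hmain
  refine hmain.trans (le_of_eq ?_)
  have hren : ∀ s, complexity (F' s) = complexity (F (e s)) := fun s =>
    complexity_rename_of_injective_holds
      (Sum.map_injective.2 ⟨Function.injective_id, e.symm.injective⟩) _
  simp only [hren]
  exact Fintype.sum_equiv e.toEquiv (fun s => complexity (F (e s))) (fun s => complexity (F s))
    (fun s => rfl)

end Literature.Computability.AlgebraicComplexity

end
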